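import Literature.NumberTheory.LFunctions.RayClassGaussSumNorm
import Literature.NumberTheory.LFunctions.RayClassesColonIdeal
import HarnessLib

/-!
# The finite part `χ_f` of a Größencharakter of infinity type `σ^m`, its primitivity and its Gauss sums (Neukirch VII §6)

Topic `Literature/NumberTheory/LFunctions`; namespace `Literature.NumberTheory.LFunctions`.  Algebraic input of Hecke's
functional equation for the `L`-series of a Größencharakter of infinity type `(m, 0)` of an imaginary quadratic field
(Hecke 1920; de Shalit 1987 II.1.1 (1)–(3); Neukirch, *Algebraic Number Theory* VII (8.5)–(8.6)), companion of
`RayClassGaussSum.lean` / `RayClassGaussSumNorm.lean`, which treat the SIGN types `(p, 0)`, `p_τ ∈ {0,1}` at real places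
(the Dirichlet characters of VII (6.9)).  Everything here is PROVED; no named fact.

## Source

> **Neukirch VII (6.1) Definition.** A Größencharakter `mod 𝔪` is a character `χ` of `J^𝔪` with
> `χ((a)) = χ_f(a) χ_∞(a)` for integers `a` prime to `𝔪`, `χ_f` a character of `(𝒪/𝔪)^*`, `χ_∞` a character of `R^*`;
> (6.2): `χ_f`, `χ_∞` are determined by `χ` ("`χ_∞(a) = χ((a))` for `a ≡ 1 mod 𝔪`").  §6 (p. 472): `χ` is *primitive* if
> `χ_f` "does not factorize through `(𝒪/𝔪')^*` for any proper divisor `𝔪' ∣ 𝔪`".  (6.3)–(6.4): the Gauss sums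
> `τ_𝔪(χ_f, y) = Σ_{x mod 𝔪, (x,𝔪)=1} χ_f(x) e^{2πi Tr(xy)}` (`y ∈ 𝔪⁻¹𝔡⁻¹`), `τ(ay) = χ̄_f(a)τ(y)` for `(a,𝔪) = 1`, `= 0` otherwise
> (primitive `χ_f`), and `|τ| = √𝔑(𝔪)`.

## The currency

The archimedean type is an embedding power: a ring homomorphism `σ : K →+* ℂ` and `m : ℕ`, `χ_∞(a) = σ(a)^m` — over an
imaginary quadratic field with `σ` the embedding of the infinite place this is de Shalit's type `(m, 0)`
(`χ((a)) = a^m` for `a ≡ 1 mod 𝔣`), with `conj ∘ σ` the type `(0, m)` of `χ̄`.  The datum `HasEmbPowType 𝔪 σ m ψ` (values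
`ψ` on the primes, `χ̃ = idealPow K ψ` the multiplicative extension to ideals) records `ψ(𝔭) ≠ 0` off `𝔪` and the
ray relation `χ̃((b)) σ(c)^m = χ̃((c)) σ(b)^m` for nonzero `b ≡ c mod 𝔪`, `c` prime to `𝔪` — exactly what the tree's
`IsGrossencharakter 𝔪 p q ψ` (`GaloisRepresentations/GrossencharakterIdeleValue.lean`) gives when the archimedean
monomial `∏_w σ_w^{p_w} σ̄_w^{q_w}` collapses to `σ^m` (the shape of `idealPow_span_mul_eq_of_isGrossencharakter` in
`RayClassesColonIdeal.lean`, there for `m = 1`).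

## Main results (all proved)

* `grossFinitePart 𝔪 ψ σ m a = χ_f(a) = χ̃((a)) / σ(a)^m` (`0` unless `a ≠ 0` is prime to `𝔪`): multiplicative, constant
  on residue classes `mod 𝔪` (`grossFinitePart_congr`), `= 1` on `a ≡ 1`, of absolute value `1`
  (`norm_grossFinitePart`: `χ_f` is a character of the finite group `(𝒪/𝔪)^*`), whence `‖χ̃((a))‖ = ‖σ a‖^m`;
  `grossFinitePart_star` (`χ̄_f` for `star ψ`, type `(conj∘σ)^m`).
* `IsPrimitiveGross 𝔪 ψ σ m` — `χ_f` does not factor through `(𝒪/𝔪')^*` for any `𝔪 ⊊ 𝔪'`.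
* `grossGaussSum 𝔪 ψ σ m y = τ_𝔪(χ_f, y)`: independence of representatives, Thm. (6.4) both cases
  (`grossGaussSum_mul_of_isCoprime`, `grossGaussSum_mul_eq_zero_of_not_isCoprime`, `grossGaussSum_mul_eq`),
  `normSq_grossGaussSum` / `norm_grossGaussSum` (`|τ| = √𝔑(𝔪)`), and the class independence of the normalised Gauss sum
  `grossGaussSum_invariant` (`χ̃(𝔶') σ(y)^m τ(y') = χ̃(𝔶) σ(y')^m τ(y)` for `𝔶 = y𝔪𝔡`, `𝔶' = y'𝔪𝔡` prime to `𝔪`).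

The proofs are those of the sign-type files, with `sgn N(a^p)` replaced by `σ(a)^{-m}` (the additive-character lemmas
`coe_fourierChar_trace_add_of_mem`, `sum_fourierChar_trace_eq_card/zero`, `mul_mem_dual_one_iff`, … are reused).

## References

* J. Neukirch, *Algebraic Number Theory*, Grundlehren 322, Springer 1999, Ch. VII §6 (6.1)–(6.4), (6.13)–(6.14); §7 before
  (7.5). [NeukirchANT1999]
* E. de Shalit, *Iwasawa theory of elliptic curves with complex multiplication*, Academic Press 1987, II §1.1. [deShalit1987]
* E. Hecke, Math. Z. 6 (1920), 11–51. [HeckeMathZ1920]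
-/

noncomputable section

open scoped FourierTransform nonZeroDivisors ComplexConjugate
open NumberField NumberField.InfinitePlace IsDedekindDomain

namespace Literature.NumberTheory.LFunctions

variable {K : Type*} [Field K] [NumberField K]

/-! ## The datum: a Größencharakter `mod 𝔪` of infinity type `σ^m` -/

/-- **`ψ mod 𝔪` is a Größencharakter of infinity type `σ^m`** (Neukirch VII (6.1)/(6.14) with `χ_∞ = σ^m`; de Shalit II.1.1,
type `(m, 0)`: "`χ((a)) = a^m` for `a ≡ 1 mod^× 𝔣`"): `ψ(𝔭) ≠ 0` for `𝔭 ∤ 𝔪`, and for nonzero integers `b ≡ c mod 𝔪` with `c`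
prime to `𝔪`, `χ̃((b)) σ(c)^m = χ̃((c)) σ(b)^m` (`χ̃ = idealPow K ψ`).  Over an imaginary quadratic field this is what
`IsGrossencharakter 𝔪 (m) (0) ψ` says. [cite: NeukirchANT1999, Ch. VII §6 Def. (6.1) and Cor. (6.14)] [cite: deShalit1987, II.1.1 (p. 32)] -/
structure HasEmbPowType (𝔪 : Ideal (𝓞 K)) (σ : K →+* ℂ) (m : ℕ) (ψ : HeightOneSpectrum (𝓞 K) → ℂ) : Prop where
  /-- Nonzero values on the primes not dividing `𝔪`. -/
  ne_zero : ∀ v : HeightOneSpectrum (𝓞 K), ¬ 𝔪 ≤ v.asIdeal → ψ v ≠ 0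
  /-- The ray relation `χ̃((b)) σ(c)^m = χ̃((c)) σ(b)^m` for nonzero `b ≡ c mod 𝔪`, `c` prime to `𝔪`. -/
  rel : ∀ b c : 𝓞 K, b ≠ 0 → c ≠ 0 → IsCoprime (Ideal.span {c}) 𝔪 → b - c ∈ 𝔪 →
    idealPow K ψ (Ideal.span {b}) * σ c ^ m = idealPow K ψ (Ideal.span {c}) * σ b ^ m

namespace HasEmbPowType

variable {𝔪 : Ideal (𝓞 K)} {σ : K →+* ℂ} {m : ℕ} {ψ : HeightOneSpectrum (𝓞 K) → ℂ}

/-- **`χ̃((a)) = σ(a)^m` for `a ≡ 1 mod 𝔪`** ("`χ_∞(a) = χ((a))` for `a ∈ 𝒪^{(𝔪)}`", Neukirch VII (6.2)).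
[cite: NeukirchANT1999, Ch. VII §6 Prop. (6.2)] -/
theorem idealPow_span_eq_pow (h : HasEmbPowType 𝔪 σ m ψ) {a : 𝓞 K} (ha : a ≠ 0) (h1 : a - 1 ∈ 𝔪) :
    idealPow K ψ (Ideal.span {a}) = σ a ^ m := by
  have hcop1 : IsCoprime (Ideal.span {(1 : 𝓞 K)}) 𝔪 := by
    rw [Ideal.span_singleton_one, ← Ideal.one_eq_top]; exact isCoprime_one_left
  have hrel := h.rel a 1 ha one_ne_zero hcop1 h1
  have h1K : ((1 : 𝓞 K) : K) = 1 := rfl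
  rw [Ideal.span_singleton_one, idealPow_top, h1K, map_one, one_pow, mul_one, one_mul] at hrel
  exact hrel

/-- `χ̃(𝔞) ≠ 0` for `𝔞 ≠ 0` prime to `𝔪`. [cite: NeukirchANT1999, Ch. VII §6 Def. (6.1)] -/
theorem idealPow_ne_zero (h : HasEmbPowType 𝔪 σ m ψ) {𝔞 : Ideal (𝓞 K)} (h𝔞 : 𝔞 ≠ ⊥) (hcop : IsCoprime 𝔞 𝔪) :
    idealPow K ψ 𝔞 ≠ 0 :=
  idealPow_ne_zero_of_isCoprime h.ne_zero h𝔞 hcop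

/-- **The conjugate datum**: `star ψ` has type `(conj ∘ σ)^m` (de Shalit: `χ̄` has type `(0, m)`).
[cite: deShalit1987, II.1.1 (3) (the character `χ̄`)] -/
theorem star (h : HasEmbPowType 𝔪 σ m ψ) : HasEmbPowType 𝔪 ((starRingEnd ℂ).comp σ) m (star ψ) where
  ne_zero v hv := by rw [Pi.star_apply, ne_eq, star_eq_zero]; exact h.ne_zero v hv
  rel b c hb hc hcop hbc := by
    simp only [idealPow_star, RingHom.comp_apply]
    rw [← map_pow (starRingEnd ℂ), ← map_pow (starRingEnd ℂ), ← map_mul (starRingEnd ℂ), ← map_mul (starRingEnd ℂ),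
      h.rel b c hb hc hcop hbc]

end HasEmbPowType

/-! ## The finite part `χ_f(a) = χ̃((a)) / σ(a)^m` (Neukirch VII (6.1)) -/

variable (K) in
/-- **The finite part `χ_f(a) = χ̃((a)) · σ(a)^{-m}`** of the Größencharakter `ψ mod 𝔪` of infinity type `σ^m`, on the integers
`a ≠ 0` prime to `𝔪` (and `0` elsewhere): the character `χ_f` of `(𝒪/𝔪)^*` of Neukirch VII (6.1), `χ((a)) = χ_f(a) χ_∞(a)`,
`χ_∞ = σ^m`. [cite: NeukirchANT1999, Ch. VII §6 Def. (6.1)] -/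
def grossFinitePart (𝔪 : Ideal (𝓞 K)) (ψ : HeightOneSpectrum (𝓞 K) → ℂ) (σ : K →+* ℂ) (m : ℕ) (a : 𝓞 K) : ℂ :=
  open scoped Classical in
  if a ≠ 0 ∧ IsCoprime (Ideal.span {a}) 𝔪 then idealPow K ψ (Ideal.span {a}) / σ a ^ m else 0

section FinitePart

variable {𝔪 : Ideal (𝓞 K)} {ψ : HeightOneSpectrum (𝓞 K) → ℂ} {σ : K →+* ℂ} {m : ℕ}

/-- Unfolding on `a ≠ 0` prime to `𝔪`. [cite: NeukirchANT1999, Ch. VII §6 Def. (6.1)] -/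
theorem grossFinitePart_of_isCoprime {a : 𝓞 K} (ha : a ≠ 0) (hcop : IsCoprime (Ideal.span {a}) 𝔪) :
    grossFinitePart K 𝔪 ψ σ m a = idealPow K ψ (Ideal.span {a}) / σ a ^ m := by
  simp only [grossFinitePart, if_pos (And.intro ha hcop)]

/-- `χ_f(a) = 0` unless `a ≠ 0` is prime to `𝔪`. [cite: NeukirchANT1999, Ch. VII §6 Def. (6.1)] -/
theorem grossFinitePart_of_not {a : 𝓞 K} (h : ¬ (a ≠ 0 ∧ IsCoprime (Ideal.span {a}) 𝔪)) :
    grossFinitePart K 𝔪 ψ σ m a = 0 := by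
  simp only [grossFinitePart, if_neg h]

/-- `χ_f(0) = 0`. [cite: NeukirchANT1999, Ch. VII §6 Def. (6.1)] -/
theorem grossFinitePart_zero : grossFinitePart K 𝔪 ψ σ m 0 = 0 := grossFinitePart_of_not (by simp)

omit [NumberField K] in
/-- `σ(a)^m ≠ 0` for `a ≠ 0`. [cite: NeukirchANT1999, Ch. VII §6 Def. (6.1)] -/
theorem emb_pow_ne_zero (σ : K →+* ℂ) (m : ℕ) {a : 𝓞 K} (ha : a ≠ 0) : σ a ^ m ≠ 0 :=
  pow_ne_zero _ ((map_ne_zero σ).mpr (by exact_mod_cast ha))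

/-- **`χ((a)) = χ_f(a) σ(a)^m`** for `a ≠ 0` prime to `𝔪`. [cite: NeukirchANT1999, Ch. VII §6 Def. (6.1)] -/
theorem grossFinitePart_mul_pow {a : 𝓞 K} (ha : a ≠ 0) (hcop : IsCoprime (Ideal.span {a}) 𝔪) :
    grossFinitePart K 𝔪 ψ σ m a * σ a ^ m = idealPow K ψ (Ideal.span {a}) := by
  rw [grossFinitePart_of_isCoprime ha hcop, div_mul_cancel₀ _ (emb_pow_ne_zero σ m ha)]

/-- `χ_f(a) σ(a)^m = χ'((a))` with the coefficient `χ'` of the `L`-series (`rayClassCoeff`: `χ̃` on ideals prime to `𝔪`, `0`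
elsewhere), for every nonzero integer `a`. [cite: NeukirchANT1999, Ch. VII §6 Def. (6.1)] -/
theorem grossFinitePart_mul_pow_eq_rayClassCoeff {a : 𝓞 K} (ha : a ≠ 0) :
    grossFinitePart K 𝔪 ψ σ m a * σ a ^ m = rayClassCoeff 𝔪 ψ (Ideal.span {a}) := by
  classical
  by_cases hcop : IsCoprime (Ideal.span {a}) 𝔪
  · rw [grossFinitePart_mul_pow ha hcop, rayClassCoeff, if_pos ⟨by simpa using ha, hcop⟩]
  · rw [grossFinitePart_of_not (fun h ↦ hcop h.2), zero_mul, rayClassCoeff, if_neg (fun h ↦ hcop h.2)]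

/-- **`χ_f` is multiplicative.** [cite: NeukirchANT1999, Ch. VII §6 Def. (6.1)] -/
theorem grossFinitePart_mul (a b : 𝓞 K) :
    grossFinitePart K 𝔪 ψ σ m (a * b) = grossFinitePart K 𝔪 ψ σ m a * grossFinitePart K 𝔪 ψ σ m b := by
  classical
  by_cases ha : a ≠ 0 ∧ IsCoprime (Ideal.span {a}) 𝔪
  · by_cases hb : b ≠ 0 ∧ IsCoprime (Ideal.span {b}) 𝔪
    · have hab : a * b ≠ 0 ∧ IsCoprime (Ideal.span {a * b}) 𝔪 :=
        ⟨mul_ne_zero ha.1 hb.1, by rw [← Ideal.span_singleton_mul_span_singleton]; exact ha.2.mul_left hb.2⟩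
      rw [grossFinitePart_of_isCoprime hab.1 hab.2, grossFinitePart_of_isCoprime ha.1 ha.2,
        grossFinitePart_of_isCoprime hb.1 hb.2, idealPow_span_mul ψ ha.1 hb.1]
      push_cast
      rw [map_mul, mul_pow, mul_div_mul_comm]
    · rw [grossFinitePart_of_not hb, mul_zero]
      refine grossFinitePart_of_not fun h => hb ⟨right_ne_zero_of_mul h.1, ?_⟩
      rw [← Ideal.span_singleton_mul_span_singleton] at h
      exact h.2.of_mul_left_right
  · rw [grossFinitePart_of_not ha, zero_mul]
    refine grossFinitePart_of_not fun h => ha ⟨left_ne_zero_of_mul h.1, ?_⟩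
    rw [← Ideal.span_singleton_mul_span_singleton] at h
    exact h.2.of_mul_left_left

/-- `χ_f(a^n) = χ_f(a)^n`. [cite: NeukirchANT1999, Ch. VII §6 Def. (6.1)] -/
theorem grossFinitePart_pow (a : 𝓞 K) (n : ℕ) :
    grossFinitePart K 𝔪 ψ σ m (a ^ n) = grossFinitePart K 𝔪 ψ σ m a ^ n := by
  induction n with
  | zero =>
    have hcop1 : IsCoprime (Ideal.span {(1 : 𝓞 K)}) 𝔪 := by
      rw [Ideal.span_singleton_one, ← Ideal.one_eq_top]; exact isCoprime_one_left
    have h1K : ((1 : 𝓞 K) : K) = 1 := rfl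
    rw [pow_zero, pow_zero, grossFinitePart_of_isCoprime one_ne_zero hcop1, Ideal.span_singleton_one, idealPow_top,
      h1K, map_one, one_pow, div_one]
  | succ n ih => rw [pow_succ, pow_succ, grossFinitePart_mul, ih]

/-- **`χ_f(a) = 1` for `a ≡ 1 mod 𝔪`**, `a ≠ 0`. [cite: NeukirchANT1999, Ch. VII §6 Prop. (6.2)] -/
theorem grossFinitePart_eq_one_of_sub_one_mem (h : HasEmbPowType 𝔪 σ m ψ) {a : 𝓞 K} (ha : a ≠ 0) (h1 : a - 1 ∈ 𝔪) :
    grossFinitePart K 𝔪 ψ σ m a = 1 := by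
  have hcop : IsCoprime (Ideal.span {a}) 𝔪 := isCoprime_span_singleton_of_sub_one_mem h1
  rw [grossFinitePart_of_isCoprime ha hcop, h.idealPow_span_eq_pow ha h1, div_self (emb_pow_ne_zero σ m ha)]

/-- `χ_f(1) = 1`. [cite: NeukirchANT1999, Ch. VII §6 Prop. (6.2)] -/
theorem grossFinitePart_one (h : HasEmbPowType 𝔪 σ m ψ) : grossFinitePart K 𝔪 ψ σ m 1 = 1 :=
  grossFinitePart_eq_one_of_sub_one_mem h one_ne_zero (by simp)

/-- **`χ_f` only depends on the residue class `mod 𝔪`**: `χ_f(a) = χ_f(a')` for nonzero `a ≡ a' mod 𝔪` (the ray relation).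
[cite: NeukirchANT1999, Ch. VII §6 Def. (6.1)] -/
theorem grossFinitePart_congr (h : HasEmbPowType 𝔪 σ m ψ) {a a' : 𝓞 K} (ha : a ≠ 0) (ha' : a' ≠ 0)
    (haa' : a - a' ∈ 𝔪) : grossFinitePart K 𝔪 ψ σ m a = grossFinitePart K 𝔪 ψ σ m a' := by
  classical
  by_cases hcop' : IsCoprime (Ideal.span {a'}) 𝔪
  · have hcop : IsCoprime (Ideal.span {a}) 𝔪 := isCoprime_span_of_sub_mem hcop' haa'
    rw [grossFinitePart_of_isCoprime ha hcop, grossFinitePart_of_isCoprime ha' hcop',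
      div_eq_div_iff (emb_pow_ne_zero σ m ha) (emb_pow_ne_zero σ m ha')]
    exact h.rel a a' ha ha' hcop' haa'
  · have hcop : ¬ IsCoprime (Ideal.span {a}) 𝔪 := fun h' =>
      hcop' (isCoprime_span_of_sub_mem h' (by rw [← neg_sub]; exact 𝔪.neg_mem haa'))
    rw [grossFinitePart_of_not (fun h => hcop h.2), grossFinitePart_of_not (fun h => hcop' h.2)]

/-- **`|χ_f(a)| = 1`** for `a ≠ 0` prime to `𝔪` (`χ_f` is a character of the FINITE group `(𝒪/𝔪)^*`: with `n = #(𝒪/𝔪)^*`,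
`a^n ≡ 1 mod 𝔪`, so `χ_f(a)^n = χ_f(a^n) = 1`). [cite: NeukirchANT1999, Ch. VII §6 Def. (6.1)] -/
theorem norm_grossFinitePart (h : HasEmbPowType 𝔪 σ m ψ) (h𝔪 : 𝔪 ≠ ⊥) {a : 𝓞 K} (ha : a ≠ 0)
    (hcop : IsCoprime (Ideal.span {a}) 𝔪) : ‖grossFinitePart K 𝔪 ψ σ m a‖ = 1 := by
  haveI : Finite (𝓞 K ⧸ 𝔪) := Ideal.finiteQuotientOfFreeOfNeBot 𝔪 h𝔪
  set u : (𝓞 K ⧸ 𝔪)ˣ := (isUnit_mk_of_isCoprime hcop).unit with hu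
  set n : ℕ := Nat.card (𝓞 K ⧸ 𝔪)ˣ with hn
  have hn0 : n ≠ 0 := Nat.card_pos.ne'
  have hun : u ^ n = 1 := pow_card_eq_one'
  have han : a ^ n - 1 ∈ 𝔪 := by
    rw [← Ideal.Quotient.eq, map_pow, map_one]
    have : (u : 𝓞 K ⧸ 𝔪) = Ideal.Quotient.mk 𝔪 a := rfl
    rw [← this, ← Units.val_pow_eq_pow_val, hun, Units.val_one]
  have hχn : grossFinitePart K 𝔪 ψ σ m a ^ n = 1 := by
    rw [← grossFinitePart_pow, grossFinitePart_eq_one_of_sub_one_mem h (pow_ne_zero _ ha) han]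
  have := congrArg (‖·‖) hχn
  simp only [norm_pow, norm_one] at this
  exact (pow_eq_one_iff_of_nonneg (norm_nonneg _) hn0).mp this

/-- `χ̄_f(a) χ_f(a) = 1` for `a ≠ 0` prime to `𝔪`. [cite: NeukirchANT1999, Ch. VII §6 Def. (6.1)] -/
theorem conj_grossFinitePart_mul_self (h : HasEmbPowType 𝔪 σ m ψ) (h𝔪 : 𝔪 ≠ ⊥) {a : 𝓞 K} (ha : a ≠ 0)
    (hcop : IsCoprime (Ideal.span {a}) 𝔪) :
    starRingEnd ℂ (grossFinitePart K 𝔪 ψ σ m a) * grossFinitePart K 𝔪 ψ σ m a = 1 := by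
  rw [← Complex.normSq_eq_conj_mul_self, Complex.normSq_eq_norm_sq, norm_grossFinitePart h h𝔪 ha hcop]; norm_num

/-- `‖χ_f(a)‖ ≤ 1` for every `a`. [cite: NeukirchANT1999, Ch. VII §6 Def. (6.1)] -/
theorem norm_grossFinitePart_le_one (h : HasEmbPowType 𝔪 σ m ψ) (h𝔪 : 𝔪 ≠ ⊥) (a : 𝓞 K) :
    ‖grossFinitePart K 𝔪 ψ σ m a‖ ≤ 1 := by
  classical
  by_cases ha : a ≠ 0 ∧ IsCoprime (Ideal.span {a}) 𝔪
  · exact (norm_grossFinitePart h h𝔪 ha.1 ha.2).le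
  · rw [grossFinitePart_of_not ha, norm_zero]; exact zero_le_one

/-- **`‖χ̃((a))‖ = ‖σ(a)‖^m`** for `a ≠ 0` prime to `𝔪` (Weil: a character of type `(A₀)` of weight `m` has `|χ(𝔞)| = N𝔞^{m/2}`;
here on principal ideals). [cite: NeukirchANT1999, Ch. VII §6 Prop. (6.13)] -/
theorem norm_idealPow_span (h : HasEmbPowType 𝔪 σ m ψ) (h𝔪 : 𝔪 ≠ ⊥) {a : 𝓞 K} (ha : a ≠ 0)
    (hcop : IsCoprime (Ideal.span {a}) 𝔪) : ‖idealPow K ψ (Ideal.span {a})‖ = ‖σ a‖ ^ m := by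
  rw [← grossFinitePart_mul_pow ha hcop, norm_mul, norm_grossFinitePart h h𝔪 ha hcop, one_mul, norm_pow]

/-- `χ̄_f = conj ∘ χ_f`: the finite part of `star ψ` (type `(conj∘σ)^m`) is the conjugate of that of `ψ`.
[cite: deShalit1987, II.1.1 (3) (the character `χ̄`)] -/
theorem grossFinitePart_star (a : 𝓞 K) :
    grossFinitePart K 𝔪 (star ψ) ((starRingEnd ℂ).comp σ) m a = starRingEnd ℂ (grossFinitePart K 𝔪 ψ σ m a) := by
  classical
  by_cases ha : a ≠ 0 ∧ IsCoprime (Ideal.span {a}) 𝔪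
  · rw [grossFinitePart_of_isCoprime ha.1 ha.2, grossFinitePart_of_isCoprime ha.1 ha.2, map_div₀, idealPow_star,
      RingHom.comp_apply, map_pow]
  · rw [grossFinitePart_of_not ha, grossFinitePart_of_not ha, map_zero]

end FinitePart

/-! ## Primitive characters (Neukirch VII §6, p. 472) -/

/-- **The Größencharakter `ψ mod 𝔪` (type `σ^m`) is primitive**: its finite part `χ_f` "does not factorize through `(𝒪/𝔪')^*`
for any proper divisor `𝔪' ∣ 𝔪`" (Neukirch VII §6, before (6.3)) — for every ideal `𝔪 ⊊ 𝔪'` there is an integer `b ≠ 0`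
prime to `𝔪` with `b ≡ 1 mod 𝔪'` and `χ_f(b) ≠ 1`.  Equivalently, `𝔪` is the conductor of `χ`.
[cite: NeukirchANT1999, Ch. VII §6, before Def. (6.3) (p. 472)] -/
structure IsPrimitiveGross (𝔪 : Ideal (𝓞 K)) (ψ : HeightOneSpectrum (𝓞 K) → ℂ) (σ : K →+* ℂ) (m : ℕ) : Prop where
  /-- `χ_f` is nontrivial on the kernel of `(𝒪/𝔪)^* → (𝒪/𝔪')^*` for every `𝔪 ⊊ 𝔪'`. -/
  exists_ne_one : ∀ 𝔪' : Ideal (𝓞 K), 𝔪 ≤ 𝔪' → 𝔪' ≠ 𝔪 →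
    ∃ b : 𝓞 K, b ≠ 0 ∧ IsCoprime (Ideal.span {b}) 𝔪 ∧ b - 1 ∈ 𝔪' ∧ grossFinitePart K 𝔪 ψ σ m b ≠ 1

/-- `χ̄` is primitive if `χ` is. [cite: NeukirchANT1999, Ch. VII §6, before Def. (6.3) (p. 472)] -/
theorem IsPrimitiveGross.star {𝔪 : Ideal (𝓞 K)} {ψ : HeightOneSpectrum (𝓞 K) → ℂ} {σ : K →+* ℂ} {m : ℕ}
    (hprim : IsPrimitiveGross 𝔪 ψ σ m) : IsPrimitiveGross 𝔪 (star ψ) ((starRingEnd ℂ).comp σ) m where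
  exists_ne_one 𝔪' hle hne := by
    obtain ⟨b, hb0, hbc, hb1, hbne⟩ := hprim.exists_ne_one 𝔪' hle hne
    refine ⟨b, hb0, hbc, hb1, fun h => hbne ?_⟩
    rw [grossFinitePart_star] at h
    rw [← Complex.conj_conj (grossFinitePart K 𝔪 ψ σ m b), h, map_one]

/-! ## Gauss sums (Neukirch VII (6.3)–(6.4)) -/

variable (K) in
/-- The general term `χ_f(x) e^{2πi Tr(xy)}` of the Gauss sum. [cite: NeukirchANT1999, Ch. VII §6 Def. (6.3)] -/
def grossGaussSummand (𝔪 : Ideal (𝓞 K)) (ψ : HeightOneSpectrum (𝓞 K) → ℂ) (σ : K →+* ℂ) (m : ℕ) (y : K) (x : 𝓞 K) : ℂ :=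
  grossFinitePart K 𝔪 ψ σ m x * ((𝐞 ((Algebra.trace ℚ K ((x : K) * y) : ℚ) : ℝ) : Circle) : ℂ)

variable (K) in
/-- **The Gauss sum `τ_𝔪(χ_f, y) = Σ_{x mod 𝔪, (x,𝔪)=1} χ_f(x) e^{2πi Tr(xy)}`** of the finite part `χ_f` of the Größencharakter
`ψ mod 𝔪` of type `σ^m`, for `y ∈ 𝔪⁻¹𝔡⁻¹`, summed over a system of nonzero representatives of `𝒪/𝔪` (`χ_f = 0` off the units;
independent of the representatives, `grossGaussSum_eq_sum`).  Neukirch VII (6.3). [cite: NeukirchANT1999, Ch. VII §6 Def. (6.3)] -/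
def grossGaussSum (𝔪 : Ideal (𝓞 K)) (ψ : HeightOneSpectrum (𝓞 K) → ℂ) (σ : K →+* ℂ) (m : ℕ) (y : K) : ℂ :=
  ∑ᶠ q : 𝓞 K ⧸ 𝔪, grossGaussSummand K 𝔪 ψ σ m y (liftNZ K 𝔪 q)

section GaussSum

variable {𝔪 : Ideal (𝓞 K)} {ψ : HeightOneSpectrum (𝓞 K) → ℂ} {σ : K →+* ℂ} {m : ℕ}

/-- **The general term only depends on `x mod 𝔪`** (for `y ∈ 𝔪⁻¹𝔡⁻¹` and nonzero `x`): `Tr(x'y) ≡ Tr(xy) mod ℤ` and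
`χ_f(x') = χ_f(x)` for `x' ≡ x`. [cite: NeukirchANT1999, Ch. VII §6 Def. (6.3)] -/
theorem grossGaussSummand_congr (h : HasEmbPowType 𝔪 σ m ψ) (h𝔪 : 𝔪 ≠ ⊥) {y : K}
    (hy : y ∈ FractionalIdeal.dual ℤ ℚ (𝔪 : FractionalIdeal (𝓞 K)⁰ K)) {x x' : 𝓞 K} (hx : x ≠ 0) (hx' : x' ≠ 0)
    (hxx' : x - x' ∈ 𝔪) : grossGaussSummand K 𝔪 ψ σ m y x = grossGaussSummand K 𝔪 ψ σ m y x' := by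
  rw [grossGaussSummand, grossGaussSummand, grossFinitePart_congr h hx hx' hxx']
  congr 1
  have : ((x : 𝓞 K) : K) = (x' : K) + ((x - x' : 𝓞 K) : K) := by push_cast; ring
  rw [this, coe_fourierChar_trace_add_of_mem h𝔪 hy _ hxx']

/-- **The Gauss sum over any system of nonzero representatives** (independence of the representatives, Neukirch VII (6.3)).
[cite: NeukirchANT1999, Ch. VII §6 Def. (6.3)] -/
theorem grossGaussSum_eq_sum [Fintype (𝓞 K ⧸ 𝔪)] (h : HasEmbPowType 𝔪 σ m ψ) (h𝔪 : 𝔪 ≠ ⊥) {y : K}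
    (hy : y ∈ FractionalIdeal.dual ℤ ℚ (𝔪 : FractionalIdeal (𝓞 K)⁰ K))
    (r : 𝓞 K ⧸ 𝔪 → 𝓞 K) (hr0 : ∀ q, r q ≠ 0) (hr : ∀ q, Ideal.Quotient.mk 𝔪 (r q) = q) :
    grossGaussSum K 𝔪 ψ σ m y = ∑ q, grossGaussSummand K 𝔪 ψ σ m y (r q) := by
  rw [grossGaussSum, finsum_eq_sum_of_fintype]
  refine Finset.sum_congr rfl fun q _ => grossGaussSummand_congr h h𝔪 hy (liftNZ_ne_zero h𝔪 q) (hr0 q) ?_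
  rw [← Ideal.Quotient.eq, mk_liftNZ h𝔪, hr]

/-- **Theorem (6.4), first case: `τ_𝔪(χ_f, ay) = χ̄_f(a) τ_𝔪(χ_f, y)` for `(a, 𝔪) = 1`** ("as `x` runs through a system of
representatives of `(𝒪/𝔪)^*`, so does `xa`"). [cite: NeukirchANT1999, Ch. VII §6 Thm. (6.4)] -/
theorem grossGaussSum_mul_of_isCoprime (h : HasEmbPowType 𝔪 σ m ψ) (h𝔪 : 𝔪 ≠ ⊥) {a : 𝓞 K} (ha0 : a ≠ 0)
    (ha : IsCoprime (Ideal.span {a}) 𝔪) {y : K} (hy : y ∈ FractionalIdeal.dual ℤ ℚ (𝔪 : FractionalIdeal (𝓞 K)⁰ K)) :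
    grossGaussSum K 𝔪 ψ σ m ((a : K) * y) =
      starRingEnd ℂ (grossFinitePart K 𝔪 ψ σ m a) * grossGaussSum K 𝔪 ψ σ m y := by
  classical
  haveI : Finite (𝓞 K ⧸ 𝔪) := Ideal.finiteQuotientOfFreeOfNeBot 𝔪 h𝔪
  haveI : Fintype (𝓞 K ⧸ 𝔪) := Fintype.ofFinite _
  set u : (𝓞 K ⧸ 𝔪)ˣ := (isUnit_mk_of_isCoprime ha).unit with hu
  have huval : (u : 𝓞 K ⧸ 𝔪) = Ideal.Quotient.mk 𝔪 a := rfl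
  have hr0 : ∀ q : 𝓞 K ⧸ 𝔪, liftNZ K 𝔪 (q * u⁻¹) * a ≠ 0 := fun q => mul_ne_zero (liftNZ_ne_zero h𝔪 _) ha0
  have hr : ∀ q : 𝓞 K ⧸ 𝔪, Ideal.Quotient.mk 𝔪 (liftNZ K 𝔪 (q * u⁻¹) * a) = q := fun q => by
    rw [map_mul, mk_liftNZ h𝔪, ← huval, Units.inv_mul_cancel_right]
  rw [grossGaussSum_eq_sum h h𝔪 (coe_mul_mem_dual hy a) (liftNZ K 𝔪) (liftNZ_ne_zero h𝔪) (mk_liftNZ h𝔪),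
    grossGaussSum_eq_sum h h𝔪 hy _ hr0 hr, Finset.mul_sum]
  refine Fintype.sum_equiv (Units.mulRight u) _ _ fun q => ?_
  rw [Units.mulRight_apply, Units.mul_inv_cancel_right]
  simp only [grossGaussSummand]
  rw [grossFinitePart_mul]
  have hc := conj_grossFinitePart_mul_self h h𝔪 ha0 ha
  push_cast
  have : ((liftNZ K 𝔪 q : 𝓞 K) : K) * ((a : K) * y) = (liftNZ K 𝔪 q : K) * (a : K) * y := by ring
  rw [this]
  linear_combination -(grossFinitePart K 𝔪 ψ σ m (liftNZ K 𝔪 q) *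
    ((𝐞 ((Algebra.trace ℚ K ((liftNZ K 𝔪 q : K) * (a : K) * y) : ℚ) : ℝ) : Circle) : ℂ)) * hc

/-- **Theorem (6.4), second case: `τ_𝔪(χ_f, ay) = 0` for `(a, 𝔪) ≠ 1` when `χ_f` is primitive** (with `𝔪' = (𝔪 : a) ⊋ 𝔪`
and `b ≡ 1 mod 𝔪'`, `χ_f(b) ≠ 1`: `χ̄_f(b) τ(ay) = τ(bay) = τ(ay)`). [cite: NeukirchANT1999, Ch. VII §6 Thm. (6.4)] -/
theorem grossGaussSum_mul_eq_zero_of_not_isCoprime (h : HasEmbPowType 𝔪 σ m ψ) (hprim : IsPrimitiveGross 𝔪 ψ σ m)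
    (h𝔪 : 𝔪 ≠ ⊥) {a : 𝓞 K} (ha : ¬ IsCoprime (Ideal.span {a}) 𝔪) {y : K}
    (hy : y ∈ FractionalIdeal.dual ℤ ℚ (𝔪 : FractionalIdeal (𝓞 K)⁰ K)) :
    grossGaussSum K 𝔪 ψ σ m ((a : K) * y) = 0 := by
  obtain ⟨z, hz, hza⟩ := exists_not_mem_mul_mem h𝔪 ha
  set 𝔪' : Ideal (𝓞 K) := Submodule.colon 𝔪 ({a} : Set (𝓞 K)) with h𝔪'
  have hle : 𝔪 ≤ 𝔪' := fun x hx => by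
    rw [h𝔪', Submodule.mem_colon_singleton, smul_eq_mul]; exact 𝔪.mul_mem_right _ hx
  have hne : 𝔪' ≠ 𝔪 := fun heq => hz (by
    rw [← heq, h𝔪', Submodule.mem_colon_singleton, smul_eq_mul]; exact hza)
  obtain ⟨b, hb0, hbcop, hb1, hfb⟩ := hprim.exists_ne_one 𝔪' hle hne
  rw [h𝔪', Submodule.mem_colon_singleton, smul_eq_mul] at hb1
  have hfb' : starRingEnd ℂ (grossFinitePart K 𝔪 ψ σ m b) ≠ 1 := fun h' => hfb (by
    rw [← Complex.conj_conj (grossFinitePart K 𝔪 ψ σ m b), h', map_one])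
  have hay : (a : K) * y ∈ FractionalIdeal.dual ℤ ℚ (𝔪 : FractionalIdeal (𝓞 K)⁰ K) := coe_mul_mem_dual hy a
  have h1 := grossGaussSum_mul_of_isCoprime h h𝔪 hb0 hbcop hay
  have h2 : grossGaussSum K 𝔪 ψ σ m ((b : K) * ((a : K) * y)) = grossGaussSum K 𝔪 ψ σ m ((a : K) * y) := by
    have : (b : K) * ((a : K) * y) = (a : K) * y + (((b - 1) : 𝓞 K) : K) * ((a : K) * y) := by push_cast; ring
    rw [this]
    refine finsum_congr fun q => ?_
    simp only [grossGaussSummand]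
    congr 1
    have : ((liftNZ K 𝔪 q : 𝓞 K) : K) * ((a : K) * y + (((b - 1) : 𝓞 K) : K) * ((a : K) * y)) =
        ((liftNZ K 𝔪 q : K) * ((a : K) * y)) + ((liftNZ K 𝔪 q * ((b - 1) * a) : 𝓞 K) : K) * y := by
      push_cast; ring
    rw [this]
    obtain ⟨n, hn⟩ := exists_int_eq_trace_of_mem_dual h𝔪 hy (𝔪.mul_mem_left (liftNZ K 𝔪 q) hb1)
    rw [map_add, ← hn, Rat.cast_add, Rat.cast_intCast, coe_fourierChar_add_int]
  rw [h2] at h1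
  have : (1 - starRingEnd ℂ (grossFinitePart K 𝔪 ψ σ m b)) * grossGaussSum K 𝔪 ψ σ m ((a : K) * y) = 0 := by
    linear_combination h1
  exact (mul_eq_zero.mp this).resolve_left (sub_ne_zero.mpr hfb'.symm)

/-- **`χ̄_f(x) τ(y) = τ(xy)` for every `x ≠ 0`** (both cases of Neukirch VII (6.4) at once; for `x` not prime to `𝔪` both sides
vanish). [cite: NeukirchANT1999, Ch. VII §6 Thm. (6.4)] -/
theorem grossGaussSum_mul_eq (h : HasEmbPowType 𝔪 σ m ψ) (hprim : IsPrimitiveGross 𝔪 ψ σ m) (h𝔪 : 𝔪 ≠ ⊥) {x : 𝓞 K}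
    (hx0 : x ≠ 0) {y : K} (hy : y ∈ FractionalIdeal.dual ℤ ℚ (𝔪 : FractionalIdeal (𝓞 K)⁰ K)) :
    grossGaussSum K 𝔪 ψ σ m ((x : K) * y) = starRingEnd ℂ (grossFinitePart K 𝔪 ψ σ m x) * grossGaussSum K 𝔪 ψ σ m y := by
  classical
  by_cases hx : IsCoprime (Ideal.span {x}) 𝔪
  · exact grossGaussSum_mul_of_isCoprime h h𝔪 hx0 hx hy
  · rw [grossFinitePart_of_not (fun h' ↦ hx h'.2), map_zero, zero_mul]
    exact grossGaussSum_mul_eq_zero_of_not_isCoprime h hprim h𝔪 hx hy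

/-- `τ_𝔪(χ̄_f, y) = conj τ_𝔪(χ_f, -y)` (termwise). [cite: NeukirchANT1999, Ch. VII §6 Def. (6.3)] -/
theorem grossGaussSum_star (y : K) :
    grossGaussSum K 𝔪 (star ψ) ((starRingEnd ℂ).comp σ) m y = starRingEnd ℂ (grossGaussSum K 𝔪 ψ σ m (-y)) := by
  rw [grossGaussSum, grossGaussSum]
  have hmap := AddMonoidHom.map_finsum_of_injective ((starRingEnd ℂ).toAddMonoidHom)
    (show Function.Injective ((starRingEnd ℂ).toAddMonoidHom) from (starRingEnd ℂ).injective)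
    (fun q : 𝓞 K ⧸ 𝔪 => grossGaussSummand K 𝔪 ψ σ m (-y) (liftNZ K 𝔪 q))
  simp only [RingHom.toAddMonoidHom_eq_coe, AddMonoidHom.coe_coe] at hmap
  rw [hmap]
  refine finsum_congr fun q => ?_
  simp only [grossGaussSummand, map_mul, grossFinitePart_star]
  congr 1
  simp only [Real.fourierChar_apply, ← Complex.exp_conj, map_mul, Complex.conj_ofReal, Complex.conj_I,
    mul_neg, map_neg, Rat.cast_neg, Complex.ofReal_neg, neg_mul, neg_neg]

/-! ### `|τ|² = 𝔑(𝔪)` -/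

/-- **`conj τ · τ = 𝔑(𝔪)` for primitive `χ_f` and `(y𝔪𝔡, 𝔪) = 1`** (Neukirch VII (6.4), last clause; proof as in
`normSq_gaussSum`: `conj τ · τ = Σ_q e(-r_q y) τ(r_q y)`, expand, swap, orthogonality). [cite: NeukirchANT1999, Ch. VII §6 Thm. (6.4)] -/
theorem normSq_grossGaussSum (h : HasEmbPowType 𝔪 σ m ψ) (hprim : IsPrimitiveGross 𝔪 ψ σ m) (h𝔪 : 𝔪 ≠ ⊥) {y : K}
    {𝔶 : Ideal (𝓞 K)}
    (h𝔶 : (𝔶 : FractionalIdeal (𝓞 K)⁰ K) = FractionalIdeal.spanSingleton (𝓞 K)⁰ y * 𝔪 * differentIdeal ℤ (𝓞 K))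
    (hc : IsCoprime 𝔶 𝔪) :
    starRingEnd ℂ (grossGaussSum K 𝔪 ψ σ m y) * grossGaussSum K 𝔪 ψ σ m y = (Ideal.absNorm 𝔪 : ℂ) := by
  classical
  haveI : Finite (𝓞 K ⧸ 𝔪) := Ideal.finiteQuotientOfFreeOfNeBot 𝔪 h𝔪
  haveI : Fintype (𝓞 K ⧸ 𝔪) := Fintype.ofFinite _
  have hy := mem_dual_of_coeIdeal_eq h𝔪 h𝔶
  set r : 𝓞 K ⧸ 𝔪 → 𝓞 K := liftNZ K 𝔪 with hr
  set e : K → ℂ := fun t ↦ ((𝐞 ((Algebra.trace ℚ K t : ℚ) : ℝ) : Circle) : ℂ) with he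
  have he_add : ∀ t t' : K, e (t + t') = e t * e t' := fun t t' ↦ by
    simp only [he, map_add, Rat.cast_add, AddChar.map_add_eq_mul, Circle.coe_mul]
  have hτ : grossGaussSum K 𝔪 ψ σ m y = ∑ q, grossFinitePart K 𝔪 ψ σ m (r q) * e ((r q : K) * y) :=
    grossGaussSum_eq_sum h h𝔪 hy r (liftNZ_ne_zero h𝔪) (mk_liftNZ h𝔪)
  have hconj_e : ∀ q, starRingEnd ℂ (e ((r q : K) * y)) = e (-((r q : K) * y)) := fun q ↦ by
    simp only [he, Real.fourierChar_apply, ← Complex.exp_conj, map_mul, Complex.conj_ofReal, Complex.conj_I,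
      mul_neg, map_neg, Rat.cast_neg, Complex.ofReal_neg, neg_mul]
  have hconjτ : starRingEnd ℂ (grossGaussSum K 𝔪 ψ σ m y) =
      ∑ q, starRingEnd ℂ (grossFinitePart K 𝔪 ψ σ m (r q)) * e (-((r q : K) * y)) := by
    rw [hτ, map_sum]
    exact Finset.sum_congr rfl fun q _ ↦ by rw [map_mul, hconj_e]
  have step1 : starRingEnd ℂ (grossGaussSum K 𝔪 ψ σ m y) * grossGaussSum K 𝔪 ψ σ m y =
      ∑ q, e (-((r q : K) * y)) * grossGaussSum K 𝔪 ψ σ m ((r q : K) * y) := by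
    rw [hconjτ, Finset.sum_mul]
    refine Finset.sum_congr rfl fun q _ ↦ ?_
    rw [grossGaussSum_mul_eq h hprim h𝔪 (liftNZ_ne_zero h𝔪 q) hy]
    ring
  have step2 : ∑ q, e (-((r q : K) * y)) * grossGaussSum K 𝔪 ψ σ m ((r q : K) * y) =
      ∑ q', grossFinitePart K 𝔪 ψ σ m (r q') * ∑ q, e ((r q : K) * (((r q' - 1 : 𝓞 K) : K) * y)) := by
    have hexp : ∀ q, grossGaussSum K 𝔪 ψ σ m ((r q : K) * y) =
        ∑ q', grossFinitePart K 𝔪 ψ σ m (r q') * e ((r q' : K) * ((r q : K) * y)) :=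
      fun q ↦ grossGaussSum_eq_sum h h𝔪 (coe_mul_mem_dual hy _) r (liftNZ_ne_zero h𝔪) (mk_liftNZ h𝔪)
    simp_rw [hexp, Finset.mul_sum]
    rw [Finset.sum_comm]
    refine Finset.sum_congr rfl fun q' _ ↦ ?_
    refine Finset.sum_congr rfl fun q _ ↦ ?_
    have : (r q : K) * (((r q' - 1 : 𝓞 K) : K) * y) = -((r q : K) * y) + (r q' : K) * ((r q : K) * y) := by push_cast; ring
    rw [this, he_add]; ring
  have step3 : ∀ q', ∑ q, e ((r q : K) * (((r q' - 1 : 𝓞 K) : K) * y)) =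
      if r q' - 1 ∈ 𝔪 then (Fintype.card (𝓞 K ⧸ 𝔪) : ℂ) else 0 := by
    intro q'
    split_ifs with hq'
    · exact sum_fourierChar_trace_eq_card h𝔪 ((mul_mem_dual_one_iff h𝔪 h𝔶 hc _).mpr hq')
    · exact sum_fourierChar_trace_eq_zero h𝔪 (coe_mul_mem_dual hy _)
        (fun h' ↦ hq' ((mul_mem_dual_one_iff h𝔪 h𝔶 hc _).mp h'))
  rw [step1, step2]
  simp_rw [step3, mul_ite, mul_zero]
  rw [Finset.sum_ite, Finset.sum_const_zero, add_zero]
  have hfilter : (Finset.univ.filter fun q' : 𝓞 K ⧸ 𝔪 ↦ r q' - 1 ∈ 𝔪) = {Ideal.Quotient.mk 𝔪 1} := by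
    ext q'
    simp only [Finset.mem_filter, Finset.mem_univ, true_and, Finset.mem_singleton]
    rw [← Ideal.Quotient.eq, mk_liftNZ h𝔪, map_one]
  rw [hfilter, Finset.sum_singleton, grossFinitePart_eq_one_of_sub_one_mem h (liftNZ_ne_zero h𝔪 _) (by
    rw [← Ideal.Quotient.eq, mk_liftNZ h𝔪, map_one]), one_mul, Ideal.absNorm_apply, Submodule.cardQuot_apply,
    Nat.card_eq_fintype_card]

/-- **`|τ_𝔪(χ_f, y)| = √𝔑(𝔪)`** (Neukirch VII (6.4)). [cite: NeukirchANT1999, Ch. VII §6 Thm. (6.4)] -/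
theorem norm_grossGaussSum (h : HasEmbPowType 𝔪 σ m ψ) (hprim : IsPrimitiveGross 𝔪 ψ σ m) (h𝔪 : 𝔪 ≠ ⊥) {y : K}
    {𝔶 : Ideal (𝓞 K)}
    (h𝔶 : (𝔶 : FractionalIdeal (𝓞 K)⁰ K) = FractionalIdeal.spanSingleton (𝓞 K)⁰ y * 𝔪 * differentIdeal ℤ (𝓞 K))
    (hc : IsCoprime 𝔶 𝔪) :
    ‖grossGaussSum K 𝔪 ψ σ m y‖ = Real.sqrt (Ideal.absNorm 𝔪) := by
  have h' := normSq_grossGaussSum h hprim h𝔪 h𝔶 hc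
  rw [← Complex.normSq_eq_conj_mul_self, Complex.normSq_eq_norm_sq] at h'
  have h'' : ‖grossGaussSum K 𝔪 ψ σ m y‖ ^ 2 = (Ideal.absNorm 𝔪 : ℝ) := by exact_mod_cast h'
  rw [← h'', Real.sqrt_sq (norm_nonneg _)]

/-! ### Class independence of the normalised Gauss sum -/

/-- **Class independence of the normalised Gauss sum.**  For `y, y' ∈ 𝔪⁻¹𝔡⁻¹ ∖ {0}` whose integral ideals `𝔶 = y𝔪𝔡`,
`𝔶' = y'𝔪𝔡` are prime to `𝔪`: `χ̃(𝔶') σ(y)^m τ_𝔪(χ_f, y') = χ̃(𝔶) σ(y')^m τ_𝔪(χ_f, y)` — i.e. the normalised Gauss sum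
`χ̃(𝔶) σ(y)^{-m} τ(y)` does not depend on `y` (Neukirch VII §7, before (7.5): `τ(χ) = χ_∞(y)⁻¹ χ(𝔶) τ_𝔪(χ_f, y)` "does not
depend on the choice of representatives", here without ideal numbers).  Proof: with `d ∈ 𝔶`, `d ≡ 1 mod 𝔪`, the integer
`a = d y'/y ∈ 𝔶'` is prime to `𝔪`, `(a)𝔶 = (d)𝔶'`, `τ(y') = τ(dy') = τ(ay) = χ̄_f(a)τ(y)`, and
`χ_f(a) = χ̃((a))/σ(a)^m = χ̃(𝔶') σ(y)^m / (χ̃(𝔶) σ(y')^m)`. [cite: NeukirchANT1999, Ch. VII §7, before Prop. (7.5)] -/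
theorem grossGaussSum_invariant (h : HasEmbPowType 𝔪 σ m ψ) (h𝔪 : 𝔪 ≠ ⊥) {y y' : K} (hy0 : y ≠ 0) (hy0' : y' ≠ 0)
    {𝔶 𝔶' : Ideal (𝓞 K)}
    (h𝔶 : (𝔶 : FractionalIdeal (𝓞 K)⁰ K) = FractionalIdeal.spanSingleton (𝓞 K)⁰ y * 𝔪 * differentIdeal ℤ (𝓞 K))
    (h𝔶' : (𝔶' : FractionalIdeal (𝓞 K)⁰ K) = FractionalIdeal.spanSingleton (𝓞 K)⁰ y' * 𝔪 * differentIdeal ℤ (𝓞 K))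
    (hc : IsCoprime 𝔶 𝔪) (hc' : IsCoprime 𝔶' 𝔪) :
    idealPow K ψ 𝔶' * σ y ^ m * grossGaussSum K 𝔪 ψ σ m y' =
      idealPow K ψ 𝔶 * σ y' ^ m * grossGaussSum K 𝔪 ψ σ m y := by
  have hm0 := coeIdeal_ne_zero' (K := K) h𝔪
  have hd0 := coeIdeal_differentIdeal_ne_zero (K := K)
  have hy := mem_dual_of_coeIdeal_eq h𝔪 h𝔶
  have hy' := mem_dual_of_coeIdeal_eq h𝔪 h𝔶'
  have hne : ∀ {z : K} {𝔷 : Ideal (𝓞 K)}, z ≠ 0 →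
      (𝔷 : FractionalIdeal (𝓞 K)⁰ K) = FractionalIdeal.spanSingleton (𝓞 K)⁰ z * 𝔪 * differentIdeal ℤ (𝓞 K) →
      𝔷 ≠ ⊥ := by
    intro z 𝔷 hz h𝔷 h0
    rw [h0, FractionalIdeal.coeIdeal_bot, eq_comm, mul_eq_zero, mul_eq_zero,
      FractionalIdeal.spanSingleton_eq_zero_iff] at h𝔷
    rcases h𝔷 with (h' | h') | h'
    · exact hz h'
    · exact hm0 h'
    · exact hd0 h'
  have h𝔶0 : 𝔶 ≠ ⊥ := hne hy0 h𝔶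
  have h𝔶0' : 𝔶' ≠ ⊥ := hne hy0' h𝔶'
  -- `d ∈ 𝔶`, `d ≡ 1 mod 𝔪`
  obtain ⟨d, hd𝔶, hd0', hd1⟩ := exists_mem_ne_zero_sub_one_mem h𝔶0 hc
  have hdmem : ((d : 𝓞 K) : K) ∈ FractionalIdeal.spanSingleton (𝓞 K)⁰ y *
      ((𝔪 : FractionalIdeal (𝓞 K)⁰ K) * differentIdeal ℤ (𝓞 K)) := by
    rw [← mul_assoc, ← h𝔶]; exact FractionalIdeal.mem_coeIdeal_of_mem _ hd𝔶
  obtain ⟨t, ht, hdt⟩ := FractionalIdeal.mem_singleton_mul.mp hdmem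
  have hamem : y' * t ∈ (𝔶' : FractionalIdeal (𝓞 K)⁰ K) := by
    rw [h𝔶', mul_assoc]
    exact FractionalIdeal.mem_singleton_mul.mpr ⟨t, ht, rfl⟩
  obtain ⟨a, ha𝔶', hay'⟩ := (FractionalIdeal.mem_coeIdeal (𝓞 K)⁰).mp hamem
  have hay'' : (a : K) = y' * t := hay'
  have hrel : (a : K) * y = (d : K) * y' := by rw [hay'', hdt]; ring
  have ha0 : a ≠ 0 := by
    rintro rfl
    have : ((d : 𝓞 K) : K) * y' = 0 := by rw [← hrel]; simp
    rcases mul_eq_zero.mp this with h' | h'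
    · exact hd0' (by exact_mod_cast h')
    · exact hy0' h'
  -- `(a) 𝔶 = (d) 𝔶'`
  have hideal : Ideal.span {a} * 𝔶 = Ideal.span {d} * 𝔶' := by
    apply FractionalIdeal.coeIdeal_injective (K := K)
    simp only [FractionalIdeal.coeIdeal_mul, FractionalIdeal.coeIdeal_span_singleton, h𝔶, h𝔶']
    rw [← mul_assoc, ← mul_assoc, FractionalIdeal.spanSingleton_mul_spanSingleton,
      ← mul_assoc, ← mul_assoc, FractionalIdeal.spanSingleton_mul_spanSingleton, hrel]
  have hdcop : IsCoprime (Ideal.span {d}) 𝔪 := isCoprime_span_singleton_of_sub_one_mem hd1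
  have hacop : IsCoprime (Ideal.span {a}) 𝔪 :=
    (show IsCoprime (Ideal.span {a} * 𝔶) 𝔪 by rw [hideal]; exact hdcop.mul_left hc').of_mul_left_left
  -- Gauss sums: `τ(y') = τ(d y') = τ(a y) = χ̄_f(a) τ(y)`
  have hG : grossGaussSum K 𝔪 ψ σ m y' = starRingEnd ℂ (grossFinitePart K 𝔪 ψ σ m a) * grossGaussSum K 𝔪 ψ σ m y := by
    rw [← grossGaussSum_mul_of_isCoprime h h𝔪 ha0 hacop hy, hrel, grossGaussSum_mul_of_isCoprime h h𝔪 hd0' hdcop hy',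
      grossFinitePart_eq_one_of_sub_one_mem h hd0' hd1, map_one, one_mul]
  -- `χ̃((a)) χ̃(𝔶) = σ(d)^m χ̃(𝔶')`
  have hI : idealPow K ψ (Ideal.span {a}) * idealPow K ψ 𝔶 = σ d ^ m * idealPow K ψ 𝔶' := by
    rw [← idealPow_mul ψ (by simpa using ha0) h𝔶0, hideal, idealPow_mul ψ (by simpa using hd0') h𝔶0',
      h.idealPow_span_eq_pow hd0' hd1]
  -- embeddings: `σ(a) σ(y) = σ(d) σ(y')`
  have hσ : σ a * σ y = σ d * σ y' := by rw [← map_mul, ← map_mul, hrel]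
  have hσm : σ a ^ m * σ y ^ m = σ d ^ m * σ y' ^ m := by rw [← mul_pow, ← mul_pow, hσ]
  -- `χ_f(a) = χ̃((a))/σ(a)^m`, `conj χ_f(a) · χ_f(a) = 1`
  have hfa : grossFinitePart K 𝔪 ψ σ m a * σ a ^ m = idealPow K ψ (Ideal.span {a}) := grossFinitePart_mul_pow ha0 hacop
  have hconj := conj_grossFinitePart_mul_self h h𝔪 ha0 hacop
  have hσa : σ a ^ m ≠ 0 := emb_pow_ne_zero σ m ha0
  have hσy : σ y ^ m ≠ 0 := pow_ne_zero _ ((map_ne_zero σ).mpr hy0)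
  have h𝔶ne : idealPow K ψ 𝔶 ≠ 0 := h.idealPow_ne_zero h𝔶0 hc
  rw [hG]
  -- it suffices to compare after multiplying by the unit `χ_f(a) σ(a)^m σ(y)^m χ̃(𝔶)`… we argue with `linear_combination`
  set χa := grossFinitePart K 𝔪 ψ σ m a with hχa
  set τy := grossGaussSum K 𝔪 ψ σ m y
  -- key scalar identity: `χ̃(𝔶') σ(y)^m conj(χa) = χ̃(𝔶) σ(y')^m`
  have hkey : idealPow K ψ 𝔶' * σ y ^ m * starRingEnd ℂ χa = idealPow K ψ 𝔶 * σ y' ^ m := by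
    -- multiply by the nonzero `χa * σ a ^ m` and use `hfa`, `hI`, `hσm`, `hconj`
    have hχa0 : χa ≠ 0 := by
      intro h0; rw [h0, mul_zero] at hconj; exact zero_ne_one hconj
    apply mul_right_cancel₀ (mul_ne_zero hχa0 hσa)
    linear_combination (idealPow K ψ 𝔶' * σ y ^ m * σ a ^ m) * hconj - (σ y' ^ m * idealPow K ψ 𝔶) * hfa -
      (σ y' ^ m) * hI + (idealPow K ψ 𝔶') * hσm
  linear_combination τy * hkey

end GaussSum

end Literature.NumberTheory.LFunctions

end
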